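import Summits.KontsevichZagierPeriods.Zeta5Search.Barrier.ConeGammaFarSliceCheck
import Summits.KontsevichZagierPeriods.Zeta5Search.Barrier.ConeGammaEnvelopeCert

/-!
# ζ(5) search — BARRIER: `C₀` TO FIRST ORDER IN THE FAR CHART — soundness I: hulls and the centre enclosures

HONEST FRAMING (cell `pub-zeta5`): systematic search; no irrationality claim unless kernel-certified. Theorems only. MODEL
objects under Brown–Zudilin's (28)+(30) ((28) observed, not proved): cert-2 g39's value function in cert-2 g38's far chart
(`FarSlice.valA`, `valH`, `valK`) and the checker `ConeGammaFarSliceCheck`. Nothing here is a statement about the size of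
any critical value of record, any γ, the cone's supremum (C2 OPEN), S-E (CONJECTURED), (TD_A) or `ζ(5)`; no number of record
moves; records in print UNMOVED. Theory seat cert-2 g40 (item «C₀ TO FIRST ORDER IN THE FAR CHART — THE CENTRE-SLICE
CERTIFICATE», part 3a).

* `mul_mem_corners` — the range of a product on a rectangle; `kRange_sound`, `kFormLogI_sound` (adapted copy of cert-2 g39's
  `formLogI_sound` for the resolved forms `β′ + z·m(s, X_c)` over box × z-interval, disclosed);
* `kAcc_sound` — the HULL INVARIANT of the resolved secants: «∀ z ∈ Z, z ≠ 0, ∀ t ∈ box ∃ v ∈ g,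
  valK t X_c z − valK c X_c z = Σ (t_i − c_i)·v_i» (g36's `hull_addHull` with `FarSlice.kform_secant`);
* `aHull_sound` (g39's `envAcc_sound` on the thirteen `Y`-free forms at the fixed abscissa), `sliceHull_sound` (the sum);
(The point enclosures `xlnxI_sound`, `hAt_sound`, `etaAt_sound`, `aCentre_sound` are in `ConeGammaFarSlicePoint`.)
-/

open Finset Set
open Literature.Analysis.ValidatedNumerics.NumericsMP

namespace Summit.KontsevichZagierPeriods.Zeta5Search.Barrier.ConeGamma

namespace FarSlice

open LemmaFBox (SC SC_pos KT coef featVal minNum maxNum sum8 lnNat box centre centre_mem minNum_le le_maxNum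
  minNum_add_maxNum cast_toNat_of_pos getD_map_range featVal_sub_eq_sum sum8_eq_sum mem_log_of_range)
open LemmaFWinBox (getI addHull zeroHull hull_zero hull_addHull getI_addHull boxOK8)
open LemmaFWin (zI mem_zI)
open Envelope (EForm Tube formVal vforms valF gxF valueV envAcc envAcc_sound tube)

/-! ### Ranges of the resolved forms -/

/-- **Range of a product on a rectangle**: for `a ≤ x ≤ b`, `c ≤ y ≤ d`, `x·y` lies between the least and the greatest
corner product. -/
theorem mul_mem_corners {a b c d x y : ℝ} (hx1 : a ≤ x) (hx2 : x ≤ b) (hy1 : c ≤ y) (hy2 : y ≤ d) :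
    min (min (a * c) (a * d)) (min (b * c) (b * d)) ≤ x * y ∧ x * y ≤ max (max (a * c) (a * d)) (max (b * c) (b * d)) := by
  -- `x·y` is between `a·y` and `b·y`; each of these between its two corners
  have hay : min (a * c) (a * d) ≤ a * y ∧ a * y ≤ max (a * c) (a * d) := by
    rcases le_or_gt 0 a with ha | ha
    · exact ⟨(min_le_left _ _).trans (mul_le_mul_of_nonneg_left hy1 ha),
        (mul_le_mul_of_nonneg_left hy2 ha).trans (le_max_right _ _)⟩
    · exact ⟨(min_le_right _ _).trans (mul_le_mul_of_nonpos_left hy2 ha.le),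
        (mul_le_mul_of_nonpos_left hy1 ha.le).trans (le_max_left _ _)⟩
  have hby : min (b * c) (b * d) ≤ b * y ∧ b * y ≤ max (b * c) (b * d) := by
    rcases le_or_gt 0 b with hb | hb
    · exact ⟨(min_le_left _ _).trans (mul_le_mul_of_nonneg_left hy1 hb),
        (mul_le_mul_of_nonneg_left hy2 hb).trans (le_max_right _ _)⟩
    · exact ⟨(min_le_right _ _).trans (mul_le_mul_of_nonpos_left hy2 hb.le),
        (mul_le_mul_of_nonpos_left hy1 hb.le).trans (le_max_left _ _)⟩
  have hxy : min (a * y) (b * y) ≤ x * y ∧ x * y ≤ max (a * y) (b * y) := by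
    rcases le_or_gt 0 y with hy | hy
    · exact ⟨(min_le_left _ _).trans (mul_le_mul_of_nonneg_right hx1 hy),
        (mul_le_mul_of_nonneg_right hx2 hy).trans (le_max_right _ _)⟩
    · exact ⟨(min_le_right _ _).trans (mul_le_mul_of_nonpos_right hx2 hy.le),
        (mul_le_mul_of_nonpos_right hx1 hy.le).trans (le_max_left _ _)⟩
  constructor
  · have := hxy.1
    rcases le_total (a * y) (b * y) with h | h
    · rw [min_eq_left h] at this; exact (min_le_left _ _).trans (hay.1.trans this)
    · rw [min_eq_right h] at this; exact (min_le_right _ _).trans (hby.1.trans this)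
  · have := hxy.2
    rcases le_total (a * y) (b * y) with h | h
    · rw [max_eq_right h] at this; exact (this.trans hby.2).trans (le_max_right _ _)
    · rw [max_eq_left h] at this; exact (this.trans hay.2).trans (le_max_left _ _)

/-- **`Q·m(t, X_c)` lies in `mRange`** for `t` in the box (`Q = 2·D·T`, `X_c = xc/Q`). -/
theorem mval_range {D T : ℕ} (hD : 0 < D) (hT : 0 < T) {lo hi : List ℕ} {t : Fin 8 → ℝ} (ht : t ∈ box D lo hi)
    (xc : ℤ) (f : KForm) :
    ((mRange T lo hi xc f).1 : ℝ) ≤ mval f t ((xc : ℝ) / (2 * D * T)) * (2 * D * T) ∧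
      mval f t ((xc : ℝ) / (2 * D * T)) * (2 * D * T) ≤ ((mRange T lo hi xc f).2 : ℝ) := by
  have h1 := minNum_le ht f.al
  have h2 := le_maxNum ht f.al
  have hQ : (2 * (D : ℝ) * T) ≠ 0 := by positivity
  have e : mval f t ((xc : ℝ) / (2 * D * T)) * (2 * D * T) = 2 * T * (featVal f.al t * D) + (f.bx : ℝ) * xc := by
    unfold mval; field_simp
  unfold mRange
  push_cast
  rw [e]
  have hT' : (0 : ℝ) ≤ 2 * T := by positivity
  constructor <;> nlinarith [mul_le_mul_of_nonneg_left h1 hT', mul_le_mul_of_nonneg_left h2 hT']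

/-- **`Q·zden·(β′ + z·m(t, X_c))` lies in `kRange`** for `t` in the box and `z` in the piece. -/
theorem kRange_sound {D T : ℕ} (hD : 0 < D) (hT : 0 < T) {lo hi : List ℕ} {t : Fin 8 → ℝ} (ht : t ∈ box D lo hi)
    (xc : ℤ) {zden : ℕ} {za zb : ℤ} {z : ℝ} (hz : z ∈ zSeg zden za zb) (f : KForm) :
    ((kRange (2 * D * T) T lo hi xc zden za zb f).1 : ℝ)
        ≤ ((f.bp : ℝ) + z * mval f t ((xc : ℝ) / (2 * D * T))) * ((2 * D * T : ℕ) * zden) ∧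
      ((f.bp : ℝ) + z * mval f t ((xc : ℝ) / (2 * D * T))) * ((2 * D * T : ℕ) * zden)
        ≤ ((kRange (2 * D * T) T lo hi xc zden za zb f).2 : ℝ) := by
  obtain ⟨m1, m2⟩ := mval_range hD hT ht xc f
  obtain ⟨c1, c2⟩ := mul_mem_corners hz.1 hz.2 m1 m2
  have e : ((f.bp : ℝ) + z * mval f t ((xc : ℝ) / (2 * D * T))) * ((2 * D * T : ℕ) * zden)
      = ((2 * D * T : ℕ) : ℝ) * zden * f.bp + (z * zden) * (mval f t ((xc : ℝ) / (2 * D * T)) * (2 * D * T)) := by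
    push_cast; ring
  rw [e]
  unfold kRange
  simp only
  push_cast
  constructor <;> linarith

/-- **Soundness of the resolved log interval** (adapted copy of cert-2 g39's `formLogI_sound`): if `kFormLogI … f = some I`
then there are reals `0 < m ≤ M` such that every number between `log m` and `log M` lies in `I` and at EVERY point of
box × piece the resolved form `β′ + z·m(t, X_c)` has modulus in `[m, M]` with one fixed strict sign. -/
theorem kFormLogI_sound {D T : ℕ} (hD : 0 < D) (hT : 0 < T) {lo hi : List ℕ} {xc : ℤ} {zden : ℕ} (hzden : 0 < zden)
    {za zb : ℤ} {f : KForm} {I : MI} (h : kFormLogI (2 * D * T) T lo hi xc zden za zb f = some I) :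
    ∃ m M : ℝ, 0 < m ∧ m ≤ M ∧ (∀ θ : ℝ, Real.log m ≤ θ → θ ≤ Real.log M → MI.mem SC θ I) ∧
      ((∀ ⦃t : Fin 8 → ℝ⦄, t ∈ box D lo hi → ∀ ⦃z : ℝ⦄, z ∈ zSeg zden za zb →
          m ≤ (f.bp : ℝ) + z * mval f t ((xc : ℝ) / (2 * D * T)) ∧ (f.bp : ℝ) + z * mval f t ((xc : ℝ) / (2 * D * T)) ≤ M) ∨
       (∀ ⦃t : Fin 8 → ℝ⦄, t ∈ box D lo hi → ∀ ⦃z : ℝ⦄, z ∈ zSeg zden za zb →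
          m ≤ -((f.bp : ℝ) + z * mval f t ((xc : ℝ) / (2 * D * T))) ∧
            -((f.bp : ℝ) + z * mval f t ((xc : ℝ) / (2 * D * T))) ≤ M)) := by
  unfold kFormLogI at h
  set AB := kRange (2 * D * T) T lo hi xc zden za zb f with hAB
  set mM := kModRange (2 * D * T) T lo hi xc zden za zb f with hmM
  by_cases hbad : mM.1 ≤ 0 ∨ mM.2 < mM.1
  · rw [if_pos hbad] at h; simp at h
  rw [if_neg hbad] at h
  rw [not_or, not_le, not_lt] at hbad
  obtain ⟨hm1, hm12⟩ := hbad
  split at h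
  swap
  · simp at h
  rename_i Lm LM LQ hLm hLM hLQ
  simp only [Option.some.injEq] at h
  subst h
  set N : ℕ := 2 * D * T * zden with hN
  have hNpos : 0 < N := by rw [hN]; positivity
  have hNr : (0 : ℝ) < N := by exact_mod_cast hNpos
  have hNc : ((2 * D * T * zden : ℕ) : ℝ) = ((2 * D * T : ℕ) : ℝ) * zden := by push_cast; ring
  have hm2 : 0 < mM.2 := lt_of_lt_of_le hm1 hm12
  set m : ℝ := (mM.1 : ℝ) / N with hmdef
  set M : ℝ := (mM.2 : ℝ) / N with hMdef
  have hm0 : 0 < m := div_pos (by exact_mod_cast hm1) hNr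
  have hmle : m ≤ M := div_le_div_of_nonneg_right (by exact_mod_cast hm12) hNr.le
  have hlm : MI.mem SC (Real.log m) (Lm.sub LQ) :=
    mem_log_of_range (D := N) (x := m) hNpos hm1 (MI.mem_logNat2 SC_pos hLm) (MI.mem_logNat2 SC_pos hLm)
      (by rw [hN]; exact MI.mem_logNat2 SC_pos hLQ)
      (by rw [hmdef, div_mul_cancel₀ _ hNr.ne']) (by rw [hmdef, div_mul_cancel₀ _ hNr.ne'])
  have hlM : MI.mem SC (Real.log M) (LM.sub LQ) :=
    mem_log_of_range (D := N) (x := M) hNpos hm2 (MI.mem_logNat2 SC_pos hLM) (MI.mem_logNat2 SC_pos hLM)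
      (by rw [hN]; exact MI.mem_logNat2 SC_pos hLQ)
      (by rw [hMdef, div_mul_cancel₀ _ hNr.ne']) (by rw [hMdef, div_mul_cancel₀ _ hNr.ne'])
  refine ⟨m, M, hm0, hmle, fun θ h1 h2 => MI.mem_span hlm hlM h1 h2, ?_⟩
  have hpt : ∀ ⦃t : Fin 8 → ℝ⦄, t ∈ box D lo hi → ∀ ⦃z : ℝ⦄, z ∈ zSeg zden za zb →
      (AB.1 : ℝ) ≤ ((f.bp : ℝ) + z * mval f t ((xc : ℝ) / (2 * D * T))) * N ∧
        ((f.bp : ℝ) + z * mval f t ((xc : ℝ) / (2 * D * T))) * N ≤ (AB.2 : ℝ) := by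
    intro t ht z hz
    have := kRange_sound hD hT ht xc hz f
    rw [hN, hNc]; exact this
  by_cases h1 : 0 < AB.1
  · have e : mM = (AB.1, AB.2) := by rw [hmM]; simp [kModRange, ← hAB, h1]
    left
    intro t ht z hz
    obtain ⟨r1, r2⟩ := hpt ht hz
    rw [hmdef, hMdef, e]
    exact ⟨by rw [div_le_iff₀ hNr]; exact r1, by rw [le_div_iff₀ hNr]; exact r2⟩
  · by_cases h2 : AB.2 < 0
    · have e : mM = (-AB.2, -AB.1) := by rw [hmM]; simp [kModRange, ← hAB, h1, h2]
      right
      intro t ht z hz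
      obtain ⟨r1, r2⟩ := hpt ht hz
      rw [hmdef, hMdef, e]
      push_cast
      exact ⟨by rw [div_le_iff₀ hNr]; linarith, by rw [le_div_iff₀ hNr]; linarith⟩
    · exfalso
      have : mM = (0, 0) := by rw [hmM]; simp [kModRange, ← hAB, h1, h2]
      rw [this] at hm1; simp at hm1

/-! ### The hull of the resolved secants -/

/-- **Soundness of the resolved hull accumulator**: for every `z ≠ 0` of the piece and every list of `Y`-forms,
«∀ t ∈ box ∃ v ∈ g, valKL F t X_c z − valKL F c X_c z = Σ (t_i − c_i)·v_i», and no form vanishes. -/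
theorem kAcc_sound {D T : ℕ} (hD : 0 < D) (hT : 0 < T) {lo hi : List ℕ} (hle : ∀ i : Fin 8, lo.getD i 0 ≤ hi.getD i 0)
    {xc : ℤ} {zden : ℕ} (hzden : 0 < zden) {za zb : ℤ} {z : ℝ} (hz : z ∈ zSeg zden za zb) (hz0 : z ≠ 0) :
    ∀ (F : List KForm) {g : List MI}, kAcc (2 * D * T) T lo hi xc zden za zb F = some g →
      (∀ t ∈ box D lo hi, ∃ v : Fin 8 → ℝ, (∀ i : Fin 8, MI.mem SC (v i) (getI g i)) ∧
        valKL F t ((xc : ℝ) / (2 * D * T)) z - valKL F (centre D lo hi) ((xc : ℝ) / (2 * D * T)) z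
          = ∑ i : Fin 8, (t i - centre D lo hi i) * v i) ∧
      (∀ f ∈ F, ∀ ⦃t : Fin 8 → ℝ⦄, t ∈ box D lo hi → (f.bp : ℝ) + z * mval f t ((xc : ℝ) / (2 * D * T)) ≠ 0)
  | [], g, h => by
    simp only [kAcc, Option.some.injEq] at h
    subst h
    refine ⟨fun t ht => ?_, fun f hf => by simp at hf⟩
    obtain ⟨v, hv, e⟩ := hull_zero D lo hi t ht
    exact ⟨v, hv, by simp [valKL] at e ⊢; exact e⟩
  | f :: F, g, h => by
    simp only [kAcc] at h
    split at h
    swap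
    · simp at h
    rename_i g' I hF hI
    simp only [Option.some.injEq] at h
    subst h
    obtain ⟨IH1, IH2⟩ := kAcc_sound hD hT hle hzden hz hz0 F hF
    obtain ⟨m, M, hm, _, hmem, hsgn⟩ := kFormLogI_sound hD hT hzden hI
    have hcmem : centre D lo hi ∈ box D lo hi := centre_mem hD hle
    set X : ℝ := (xc : ℝ) / (2 * D * T) with hX
    refine ⟨fun t ht => ?_, fun f' hf' => ?_⟩
    · have hG : ∀ u ∈ box D lo hi, ∃ θ : ℝ, MI.mem SC θ I ∧
          xlnx ((f.bp : ℝ) + z * mval f u X) / z - xlnx ((f.bp : ℝ) + z * mval f (centre D lo hi) X) / z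
            = θ * (featVal f.al u - featVal f.al (centre D lo hi)) := by
        intro u hu
        have hsign : (m ≤ (f.bp : ℝ) + z * mval f (centre D lo hi) X ∧ (f.bp : ℝ) + z * mval f (centre D lo hi) X ≤ M ∧
            m ≤ (f.bp : ℝ) + z * mval f u X ∧ (f.bp : ℝ) + z * mval f u X ≤ M) ∨
            (m ≤ -((f.bp : ℝ) + z * mval f (centre D lo hi) X) ∧ -((f.bp : ℝ) + z * mval f (centre D lo hi) X) ≤ M ∧
            m ≤ -((f.bp : ℝ) + z * mval f u X) ∧ -((f.bp : ℝ) + z * mval f u X) ≤ M) := by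
          rcases hsgn with hp | hn
          · exact Or.inl ⟨(hp hcmem hz).1, (hp hcmem hz).2, (hp hu hz).1, (hp hu hz).2⟩
          · exact Or.inr ⟨(hn hcmem hz).1, (hn hcmem hz).2, (hn hu hz).1, (hn hu hz).2⟩
        obtain ⟨θ, h1, h2, e⟩ := kform_secant (bp := (f.bp : ℝ)) (mt := mval f u X) (mc := mval f (centre D lo hi) X)
          hm hz0 hsign
        refine ⟨θ, hmem θ h1 h2, ?_⟩
        rw [← sub_div, e, mval_sub]
      obtain ⟨v, hv, e⟩ := hull_addHull (IH1) (k := f.sg) hG t ht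
      refine ⟨v, hv, ?_⟩
      rw [valKL_cons, valKL_cons]
      linarith
    · rcases List.mem_cons.mp hf' with rfl | hmem'
      · intro t ht h0
        rcases hsgn with hp | hn
        · have := (hp ht hz).1; rw [h0] at this; linarith
        · have := (hn ht hz).1; rw [h0] at this; linarith
      · exact IH2 f' hmem'

/-! ### The `Y`-free hull and the sum of the two hulls -/

/-- The fixed abscissa as a point of the degenerate tube `{X_c} × {0}`. -/
theorem xc_mem_tube {D T : ℕ} (hD : 0 < D) (hT : 0 < T) (xc : ℤ) :
    (((xc : ℝ) / (2 * D * T)), (0 : ℝ)) ∈ tube D T ⟨xc, xc, 0, 0⟩ := by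
  have hQ : (2 * (D : ℝ) * T) ≠ 0 := by positivity
  simp only [tube, Set.mem_setOf_eq, div_mul_cancel₀ _ hQ, zero_mul, Int.cast_zero, le_refl, and_self]

/-- **The `Y`-free hull** (g39's `envAcc_sound`, hull part, on the thirteen forms at `X_c`). -/
theorem aHull_sound {D T : ℕ} (hD : 0 < D) (hT0 : 0 < T / 2) (hT2 : T % 2 = 0) {lo hi : List ℕ}
    (hle : ∀ i : Fin 8, lo.getD i 0 ≤ hi.getD i 0) {xc : ℤ} {g : List MI} (h : aHull D T lo hi xc = some g) :
    ∀ t ∈ box D lo hi, ∃ v : Fin 8 → ℝ, (∀ i : Fin 8, MI.mem SC (v i) (getI g i)) ∧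
      valA t ((xc : ℝ) / (2 * D * T)) - valA (centre D lo hi) ((xc : ℝ) / (2 * D * T))
        = ∑ i : Fin 8, (t i - centre D lo hi i) * v i := by
  unfold aHull at h
  split at h
  swap
  · simp at h
  rename_i g' e hacc
  simp only [Option.some.injEq] at h
  subst h
  obtain ⟨H, _, _⟩ := envAcc_sound hD hT0 hT2 hle (tb := ⟨xc, xc, 0, 0⟩) (dX := 0) (dY := 0) aforms hacc
  intro t ht
  obtain ⟨v, hv, e⟩ := H (xc_mem_tube hD (by omega) xc) t ht
  refine ⟨v, hv, ?_⟩
  rw [valF_aforms_Y, valF_aforms_Y] at e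
  exact e

/-- Entries of `addHulls`. -/
theorem getI_addHulls (g h : List MI) (i : Fin 8) : getI (addHulls g h) i = (getI g i).add (getI h i) := by
  unfold addHulls getI
  rw [getD_map_range _ _ i.isLt]

/-- **THE HULL OF THE CENTRE SLICE**: if `sliceHull … = some hull` then for every `z ≠ 0` of `Z` and every `t` of the box
there is `u ∈ hull` with `(valA t X_c + valK t X_c z) − (valA c X_c + valK c X_c z) = Σ_i (t_i − c_i)·u_i`, and no resolved
form vanishes on box × `Z`. -/
theorem sliceHull_sound {D T : ℕ} (hD : 0 < D) (hT0 : 0 < T / 2) (hT2 : T % 2 = 0) {lo hi : List ℕ}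
    (hle : ∀ i : Fin 8, lo.getD i 0 ≤ hi.getD i 0) {fd : CritFar.FarData} (hzden : 0 < fd.zden) {sd : SliceData}
    {hull : List MI} (h : sliceHull D T lo hi fd sd = some hull) {z : ℝ} (hz : z ∈ zSeg fd.zden fd.zlo fd.zhi)
    (hz0 : z ≠ 0) :
    (∀ t ∈ box D lo hi, ∃ u : Fin 8 → ℝ, (∀ i : Fin 8, MI.mem SC (u i) (getI hull i)) ∧
      (valA t ((sd.xc : ℝ) / (2 * D * T)) + valK t ((sd.xc : ℝ) / (2 * D * T)) z)
        - (valA (centre D lo hi) ((sd.xc : ℝ) / (2 * D * T)) + valK (centre D lo hi) ((sd.xc : ℝ) / (2 * D * T)) z)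
        = ∑ i : Fin 8, (t i - centre D lo hi i) * u i) ∧
    (∀ f ∈ kforms, ∀ ⦃t : Fin 8 → ℝ⦄, t ∈ box D lo hi → (f.bp : ℝ) + z * mval f t ((sd.xc : ℝ) / (2 * D * T)) ≠ 0) := by
  have hT : 0 < T := by omega
  unfold sliceHull at h
  split at h
  swap
  · simp at h
  rename_i gA gK hA hK
  simp only [Option.some.injEq] at h
  subst h
  have HA := aHull_sound hD hT0 hT2 hle hA
  obtain ⟨HK, HN⟩ := kAcc_sound hD hT hle hzden hz hz0 kforms hK
  refine ⟨fun t ht => ?_, HN⟩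
  obtain ⟨v, hv, e1⟩ := HA t ht
  obtain ⟨w, hw, e2⟩ := HK t ht
  refine ⟨fun i => v i + w i, fun i => ?_, ?_⟩
  · rw [getI_addHulls]; exact MI.mem_add (hv i) (hw i)
  · rw [valK_eq_valKL, valK_eq_valKL]
    have : ∑ i : Fin 8, (t i - centre D lo hi i) * (v i + w i)
        = ∑ i : Fin 8, (t i - centre D lo hi i) * v i + ∑ i : Fin 8, (t i - centre D lo hi i) * w i := by
      rw [← Finset.sum_add_distrib]; exact Finset.sum_congr rfl fun i _ => by ring
    rw [this, ← e1, ← e2]; ring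

end FarSlice

end Summit.KontsevichZagierPeriods.Zeta5Search.Barrier.ConeGamma
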